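import Mathlib
import HarnessLib

/-!
# QUANT lane R8, front "FAR beyond trees", layer one — THE RATIO INEQUALITY (C) OF THE ONE-VERTEX DECOUPLING STEP,
# abstract-sum form, part 1: the pair inequality, (T1), (T2) and (∗∗∗)

builds on p205010 (kernel theorem, internal audit signed; external expert review pending)

Support file (`--supports stmt-CriticalPhenomena-4575`), seat `prim-quant-p1` (gen 21); memo
`run/shared/lean/prim/quant/prim-quant-p1-g21/FOR-LEAD-CYCDEC.md` §3–§4.  Standard axioms; no sorries; no definitions.
Part 2 (`T/…QuantFarDecRatio`) assembles `(V1)`, the boosted increment, `(C1)` and `(C)`.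

THE SETTING IN WORDS (memo §3).  Hubs `1, …, n` carry independent counts `W_i` (law `(z_i, s_i, d_i)` on `{0,1,≥2}`,
`u_i = 1 − z_i`); the right arm covers the suffix `Q = [ρ..n]` (`P(ρ = 1) = β`: then `Q` = everything), the left arm the
prefix `P = [1..L]` (`P(L ≥ i) = A_i`), independently.  Conditionally on `ρ ≥ 2` write `F = [1, ρ)` (the free zone, `1 ∈ F`),
`Zq, Sq, Dq = P(X_Q = 0), P(X_Q = 1), P(X_Q ≥ 2)`, `ZF = P(X_F = 0)`, `DF = P(X_F ≥ 2)`, `g1, g2 = P(the left arm collects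
≥ 1, ≥ 2 units in F)`; globally `Zall = P(X_all = 0) = Zq·ZF`, `D2all = P(X_all ≥ 2) = Dq + Sq·(1 − ZF) + Zq·DF` (for every
`ρ`), and the elementary bounds `A_1u_1 ≤ g1 ≤ A_1(1 − ZF)`, `g2 ≤ A_1·DF`, `ZF ≤ z_1` (hub `1 ∈ F`; collecting anything
needs `L ≥ 1`).  The per-`ρ` increments of the left arm added to `Q` are
`a = Zq·g2 + Sq·g1 = P(X_Q ≤ 1 < X_R | ρ)`, `c = Zq·g1 = P(X_Q = 0 < X_R | ρ)`, and the levels `b = Zq(1 − g1) = P(X_R = 0 | ρ)`,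
`d = a + Dq = P(X_R ≥ 2 | ρ)`; so `N₀ = Σ_ρ P_ρ a`, `Dn₀ = Σ_ρ P_ρ c`, `1 − H = βZall + Σ_ρ P_ρ b`, `T = βD2all + Σ_ρ P_ρ d`
(`Σ_ρ P_ρ = 1 − β`).  THIS FILE takes all of these as real-valued data on a finite index set with exactly those relations as
hypotheses (the instantiation for the percolation law is bookkeeping, memo §6) and proves:

* `ratio_pair` — the symmetrised pair inequality `u₁(ab' + a'b + cd' + c'd) ≤ (c + c')·D2all` (identity
  `ab' + a'b + cd' + c'd = ZqZq'(g2 + g2') + Zq'Sq·g1 + ZqSq'·g1' + Zq·g1·Dq' + Zq'·g1'·Dq` + termwise bounds);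
* `ratio_T2` — `u₁·a·Zall ≤ z₁·c·D2all`;  `ratio_T1` — `x·a·b' ≤ (1 − x)·c'·d` (`x = A_1u_1`);
* `ratio_threeStar` — `u₁·(N₀·(1 − H) + Dn₀·T) ≤ Dn₀·D2all`  (β-part by `ratio_T2`, main part by symmetrisation + `ratio_pair`).
[this work]
-/
namespace Summit.CriticalPhenomena.PercolationContinuityZ3.Theorems

namespace Quant

namespace Block

open Finset

/-- **Symmetrised pair inequality** (memo §4 (P)).  Two indices `ρ, ρ'` with data `(Zq, Sq, Dq, g1, g2, ZF, DF)` and primed;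
`a = Zq·g2 + Sq·g1`, `b = Zq(1 − g1)`, `c = Zq·g1`, `d = a + Dq`.  Then `u₁(ab' + a'b + cd' + c'd) ≤ (c + c')·D2all`.
Uses only `A₁u₁ ≤ g1 ≤ A₁(1 − ZF)`, `g2 ≤ A₁·DF` (both indices) and the two decompositions of `D2all`. [this work] -/
theorem ratio_pair (A1 u1 D2all Zq Sq Dq g1 g2 ZF DF Zq' Sq' Dq' g1' g2' ZF' DF' : ℝ)
    (hu0 : 0 ≤ u1) (hu1 : u1 ≤ 1)
    (hZq : 0 ≤ Zq) (hSq : 0 ≤ Sq) (hDq : 0 ≤ Dq) (hg1 : 0 ≤ g1) (hZF : ZF ≤ 1) (hDF : 0 ≤ DF)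
    (hZq' : 0 ≤ Zq') (hSq' : 0 ≤ Sq') (hDq' : 0 ≤ Dq') (hg1' : 0 ≤ g1') (hZF' : ZF' ≤ 1) (hDF' : 0 ≤ DF')
    (hx : A1 * u1 ≤ g1) (hgU : g1 ≤ A1 * (1 - ZF)) (hg2 : g2 ≤ A1 * DF)
    (hx' : A1 * u1 ≤ g1') (hgU' : g1' ≤ A1 * (1 - ZF')) (hg2' : g2' ≤ A1 * DF')
    (hD : D2all = Dq + Sq * (1 - ZF) + Zq * DF) (hD' : D2all = Dq' + Sq' * (1 - ZF') + Zq' * DF') :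
    u1 * ((Zq * g2 + Sq * g1) * (Zq' * (1 - g1')) + (Zq' * g2' + Sq' * g1') * (Zq * (1 - g1))
          + (Zq * g1) * (Zq' * g2' + Sq' * g1' + Dq') + (Zq' * g1') * (Zq * g2 + Sq * g1 + Dq))
      ≤ (Zq * g1 + Zq' * g1') * D2all := by
  -- the telescoping identity
  have hid : (Zq * g2 + Sq * g1) * (Zq' * (1 - g1')) + (Zq' * g2' + Sq' * g1') * (Zq * (1 - g1))
          + (Zq * g1) * (Zq' * g2' + Sq' * g1' + Dq') + (Zq' * g1') * (Zq * g2 + Sq * g1 + Dq)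
        = Zq * Zq' * (g2 + g2') + Zq' * Sq * g1 + Zq * Sq' * g1' + Zq * g1 * Dq' + Zq' * g1' * Dq := by ring
  rw [hid]
  have hZF1 : 0 ≤ 1 - ZF := by linarith
  have hZF1' : 0 ≤ 1 - ZF' := by linarith
  -- termwise bounds
  have e1 : u1 * g2 ≤ g1' * DF := by
    have h1 : u1 * g2 ≤ u1 * (A1 * DF) := mul_le_mul_of_nonneg_left hg2 hu0
    have h2 : (A1 * u1) * DF ≤ g1' * DF := mul_le_mul_of_nonneg_right hx' hDF
    have h3 : u1 * (A1 * DF) = (A1 * u1) * DF := by ring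
    linarith
  have e2 : u1 * g2' ≤ g1 * DF' := by
    have h1 : u1 * g2' ≤ u1 * (A1 * DF') := mul_le_mul_of_nonneg_left hg2' hu0
    have h2 : (A1 * u1) * DF' ≤ g1 * DF' := mul_le_mul_of_nonneg_right hx hDF'
    have h3 : u1 * (A1 * DF') = (A1 * u1) * DF' := by ring
    linarith
  have e3 : u1 * g1 ≤ g1' * (1 - ZF) := by
    have h1 : u1 * g1 ≤ u1 * (A1 * (1 - ZF)) := mul_le_mul_of_nonneg_left hgU hu0
    have h2 : (A1 * u1) * (1 - ZF) ≤ g1' * (1 - ZF) := mul_le_mul_of_nonneg_right hx' hZF1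
    have h3 : u1 * (A1 * (1 - ZF)) = (A1 * u1) * (1 - ZF) := by ring
    linarith
  have e4 : u1 * g1' ≤ g1 * (1 - ZF') := by
    have h1 : u1 * g1' ≤ u1 * (A1 * (1 - ZF')) := mul_le_mul_of_nonneg_left hgU' hu0
    have h2 : (A1 * u1) * (1 - ZF') ≤ g1 * (1 - ZF') := mul_le_mul_of_nonneg_right hx hZF1'
    have h3 : u1 * (A1 * (1 - ZF')) = (A1 * u1) * (1 - ZF') := by ring
    linarith
  have p1 : u1 * (Zq * Zq' * g2) ≤ Zq * Zq' * (g1' * DF) := by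
    have := mul_le_mul_of_nonneg_left e1 (mul_nonneg hZq hZq')
    have e : Zq * Zq' * (u1 * g2) = u1 * (Zq * Zq' * g2) := by ring
    linarith
  have p2 : u1 * (Zq * Zq' * g2') ≤ Zq * Zq' * (g1 * DF') := by
    have := mul_le_mul_of_nonneg_left e2 (mul_nonneg hZq hZq')
    have e : Zq * Zq' * (u1 * g2') = u1 * (Zq * Zq' * g2') := by ring
    linarith
  have p3 : u1 * (Zq' * Sq * g1) ≤ Zq' * Sq * (g1' * (1 - ZF)) := by
    have := mul_le_mul_of_nonneg_left e3 (mul_nonneg hZq' hSq)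
    have e : Zq' * Sq * (u1 * g1) = u1 * (Zq' * Sq * g1) := by ring
    linarith
  have p4 : u1 * (Zq * Sq' * g1') ≤ Zq * Sq' * (g1 * (1 - ZF')) := by
    have := mul_le_mul_of_nonneg_left e4 (mul_nonneg hZq hSq')
    have e : Zq * Sq' * (u1 * g1') = u1 * (Zq * Sq' * g1') := by ring
    linarith
  have p5 : u1 * (Zq * g1 * Dq') ≤ Zq * g1 * Dq' := by
    have h0 : 0 ≤ Zq * g1 * Dq' := mul_nonneg (mul_nonneg hZq hg1) hDq'
    have := mul_le_mul_of_nonneg_right hu1 h0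
    linarith
  have p6 : u1 * (Zq' * g1' * Dq) ≤ Zq' * g1' * Dq := by
    have h0 : 0 ≤ Zq' * g1' * Dq := mul_nonneg (mul_nonneg hZq' hg1') hDq
    have := mul_le_mul_of_nonneg_right hu1 h0
    linarith
  -- the right-hand side, decomposed once at ρ' (for the `Zq g1` copy) and once at ρ (for the `Zq' g1'` copy)
  have hR : (Zq * g1 + Zq' * g1') * D2all
      = Zq * g1 * (Dq' + Sq' * (1 - ZF') + Zq' * DF') + Zq' * g1' * (Dq + Sq * (1 - ZF) + Zq * DF) := by
    rw [add_mul, ← hD', ← hD]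
  rw [hR]
  linarith [p1, p2, p3, p4, p5, p6]

/-- **(T2)**: `u₁·a·Zall ≤ z₁·c·D2all` (memo §4): `Zall = Zq·ZF`, `D2all ≥ Zq·DF + Sq·(1 − ZF)`, `ZF ≤ z₁`, `u₁ + z₁ = 1`,
`g2 ≤ A₁·DF`, `A₁u₁ ≤ g1`. [this work] -/
theorem ratio_T2 (A1 u1 z1 Zall D2all Zq Sq Dq g1 g2 ZF DF : ℝ)
    (hu0 : 0 ≤ u1) (huz : u1 + z1 = 1)
    (hZq : 0 ≤ Zq) (hSq : 0 ≤ Sq) (hDq : 0 ≤ Dq) (hg1 : 0 ≤ g1) (hZF : 0 ≤ ZF) (hDF : 0 ≤ DF)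
    (hx : A1 * u1 ≤ g1) (hg2 : g2 ≤ A1 * DF) (hZFz : ZF ≤ z1)
    (hZall : Zall = Zq * ZF) (hD : D2all = Dq + Sq * (1 - ZF) + Zq * DF) :
    u1 * (Zq * g2 + Sq * g1) * Zall ≤ z1 * (Zq * g1) * D2all := by
  have hz1 : 0 ≤ z1 := le_trans hZF hZFz
  -- piece 1: u1 ZF g2 ≤ z1 g1 DF
  have q1 : u1 * ZF * g2 ≤ z1 * g1 * DF := by
    have h1 : u1 * ZF * g2 ≤ u1 * ZF * (A1 * DF) := mul_le_mul_of_nonneg_left hg2 (mul_nonneg hu0 hZF)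
    have h2 : (A1 * u1) * DF ≤ g1 * DF := mul_le_mul_of_nonneg_right hx hDF
    -- u1 ZF (A1 DF) = ZF ((A1 u1) DF) ≤ ZF (g1 DF) ≤ z1 (g1 DF)
    have h3 : ZF * ((A1 * u1) * DF) ≤ ZF * (g1 * DF) := mul_le_mul_of_nonneg_left h2 hZF
    have h4 : ZF * (g1 * DF) ≤ z1 * (g1 * DF) := mul_le_mul_of_nonneg_right hZFz (mul_nonneg hg1 hDF)
    have h5 : u1 * ZF * (A1 * DF) = ZF * ((A1 * u1) * DF) := by ring
    linarith
  -- piece 2: u1 ZF ≤ z1 (1 - ZF)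
  have q2 : u1 * ZF ≤ z1 * (1 - ZF) := by
    have hu : u1 = 1 - z1 := by linarith
    rw [hu]
    have := hZFz
    nlinarith
  have r1 : u1 * (Zq * Zq * ZF * g2) ≤ z1 * (Zq * Zq * g1 * DF) := by
    have := mul_le_mul_of_nonneg_left q1 (mul_nonneg hZq hZq)
    have e1 : Zq * Zq * (u1 * ZF * g2) = u1 * (Zq * Zq * ZF * g2) := by ring
    have e2 : Zq * Zq * (z1 * g1 * DF) = z1 * (Zq * Zq * g1 * DF) := by ring
    linarith
  have r2 : u1 * (Zq * Sq * ZF * g1) ≤ z1 * (Zq * Sq * g1 * (1 - ZF)) := by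
    have := mul_le_mul_of_nonneg_left q2 (mul_nonneg (mul_nonneg hZq hSq) hg1)
    have e1 : Zq * Sq * g1 * (u1 * ZF) = u1 * (Zq * Sq * ZF * g1) := by ring
    have e2 : Zq * Sq * g1 * (z1 * (1 - ZF)) = z1 * (Zq * Sq * g1 * (1 - ZF)) := by ring
    linarith
  have r3 : 0 ≤ z1 * (Zq * g1) * Dq := mul_nonneg (mul_nonneg hz1 (mul_nonneg hZq hg1)) hDq
  rw [hZall, hD]
  have e : u1 * (Zq * g2 + Sq * g1) * (Zq * ZF) = u1 * (Zq * Zq * ZF * g2) + u1 * (Zq * Sq * ZF * g1) := by ring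
  have e' : z1 * (Zq * g1) * (Dq + Sq * (1 - ZF) + Zq * DF)
      = z1 * (Zq * g1) * Dq + z1 * (Zq * Sq * g1 * (1 - ZF)) + z1 * (Zq * Zq * g1 * DF) := by ring
  rw [e, e']
  linarith [r1, r2, r3]

/-- **(T1)**: `x·a·b' ≤ (1 − x)·c'·d` for `0 ≤ x = A₁u₁ ≤ g1' ≤ 1` (`a ≤ d` since `Dq ≥ 0`). [this work] -/
theorem ratio_T1 (x Zq Sq Dq g1 g2 Zq' g1' : ℝ)
    (ha : 0 ≤ Zq * g2 + Sq * g1) (hDq : 0 ≤ Dq) (hZq' : 0 ≤ Zq') (hx0 : 0 ≤ x) (hx : x ≤ g1') (hg1' : g1' ≤ 1) :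
    x * (Zq * g2 + Sq * g1) * (Zq' * (1 - g1')) ≤ (1 - x) * (Zq' * g1') * (Zq * g2 + Sq * g1 + Dq) := by
  have h1 : x * (1 - g1') ≤ (1 - x) * g1' := by nlinarith
  have h2 : x * (Zq' * (1 - g1')) ≤ (1 - x) * (Zq' * g1') := by
    have := mul_le_mul_of_nonneg_left h1 hZq'
    have e1 : Zq' * (x * (1 - g1')) = x * (Zq' * (1 - g1')) := by ring
    have e2 : Zq' * ((1 - x) * g1') = (1 - x) * (Zq' * g1') := by ring
    linarith
  have h3 : x * (Zq * g2 + Sq * g1) * (Zq' * (1 - g1')) ≤ (1 - x) * (Zq' * g1') * (Zq * g2 + Sq * g1) := by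
    have := mul_le_mul_of_nonneg_left h2 ha
    have e1 : (Zq * g2 + Sq * g1) * (x * (Zq' * (1 - g1'))) = x * (Zq * g2 + Sq * g1) * (Zq' * (1 - g1')) := by ring
    have e2 : (Zq * g2 + Sq * g1) * ((1 - x) * (Zq' * g1')) = (1 - x) * (Zq' * g1') * (Zq * g2 + Sq * g1) := by ring
    linarith
  have h4 : 0 ≤ (1 - x) * (Zq' * g1') * Dq := mul_nonneg (mul_nonneg (by linarith) (mul_nonneg hZq' (by linarith))) hDq
  have e : (1 - x) * (Zq' * g1') * (Zq * g2 + Sq * g1 + Dq)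
      = (1 - x) * (Zq' * g1') * (Zq * g2 + Sq * g1) + (1 - x) * (Zq' * g1') * Dq := by ring
  rw [e]
  linarith [h3, h4]

section Sums

variable {ι : Type*} (S : Finset ι) (P Zq Sq Dq g1 g2 ZF DF : ι → ℝ)
variable (A1 u1 z1 β Zall D2all : ℝ)

/-- **(∗∗∗)** `u₁·(N₀·(1 − H) + Dn₀·T) ≤ Dn₀·D2all` (memo §4).  The `β`-terms are `ratio_T2`; the double sum is
`≤ 0` by symmetrisation and `ratio_pair`. [this work] -/
theorem ratio_threeStar
    (hP : ∀ ρ ∈ S, 0 ≤ P ρ) (hsum : ∑ ρ ∈ S, P ρ = 1 - β) (hβ0 : 0 ≤ β)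
    (hu0 : 0 ≤ u1) (hu1 : u1 ≤ 1) (huz : u1 + z1 = 1)
    (hZq : ∀ ρ ∈ S, 0 ≤ Zq ρ) (hSq : ∀ ρ ∈ S, 0 ≤ Sq ρ) (hDq : ∀ ρ ∈ S, 0 ≤ Dq ρ) (hg1 : ∀ ρ ∈ S, 0 ≤ g1 ρ)
    (hZF : ∀ ρ ∈ S, 0 ≤ ZF ρ) (hDF : ∀ ρ ∈ S, 0 ≤ DF ρ)
    (hx : ∀ ρ ∈ S, A1 * u1 ≤ g1 ρ) (hgU : ∀ ρ ∈ S, g1 ρ ≤ A1 * (1 - ZF ρ)) (hg2 : ∀ ρ ∈ S, g2 ρ ≤ A1 * DF ρ)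
    (hZFz : ∀ ρ ∈ S, ZF ρ ≤ z1)
    (hZall : ∀ ρ ∈ S, Zall = Zq ρ * ZF ρ) (hD : ∀ ρ ∈ S, D2all = Dq ρ + Sq ρ * (1 - ZF ρ) + Zq ρ * DF ρ)
    (N0 Dn0 omH T : ℝ)
    (hN0 : N0 = ∑ ρ ∈ S, P ρ * (Zq ρ * g2 ρ + Sq ρ * g1 ρ))
    (hDn0 : Dn0 = ∑ ρ ∈ S, P ρ * (Zq ρ * g1 ρ))
    (homH : omH = β * Zall + ∑ ρ ∈ S, P ρ * (Zq ρ * (1 - g1 ρ)))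
    (hT : T = β * D2all + ∑ ρ ∈ S, P ρ * (Zq ρ * g2 ρ + Sq ρ * g1 ρ + Dq ρ)) :
    u1 * (N0 * omH + Dn0 * T) ≤ Dn0 * D2all := by
  classical
  have hz1le : z1 ≤ 1 := by linarith
  -- abbreviations (as functions)
  set a : ι → ℝ := fun ρ => Zq ρ * g2 ρ + Sq ρ * g1 ρ with ha
  set b : ι → ℝ := fun ρ => Zq ρ * (1 - g1 ρ) with hb
  set c : ι → ℝ := fun ρ => Zq ρ * g1 ρ with hc
  set d : ι → ℝ := fun ρ => Zq ρ * g2 ρ + Sq ρ * g1 ρ + Dq ρ with hd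
  set As := ∑ ρ ∈ S, P ρ * a ρ with hAs
  set Bs := ∑ ρ ∈ S, P ρ * b ρ with hBs
  set Cs := ∑ ρ ∈ S, P ρ * c ρ with hCs
  set Ds := ∑ ρ ∈ S, P ρ * d ρ with hDs
  have hN0' : N0 = As := by rw [hN0]
  have hDn0' : Dn0 = Cs := by rw [hDn0]
  have homH' : omH = β * Zall + Bs := by rw [homH]
  have hT' : T = β * D2all + Ds := by rw [hT]
  -- β-part: per ρ, u1 (a Zall + c D2all) ≤ c D2all, summed with weights P
  have hβpart : u1 * (As * Zall + Cs * D2all) ≤ Cs * D2all := by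
    have hpt : ∀ ρ ∈ S, P ρ * (u1 * (a ρ * Zall + c ρ * D2all)) ≤ P ρ * (c ρ * D2all) := by
      intro ρ hρ
      apply mul_le_mul_of_nonneg_left _ (hP ρ hρ)
      have t2 := ratio_T2 A1 u1 z1 Zall D2all (Zq ρ) (Sq ρ) (Dq ρ) (g1 ρ) (g2 ρ) (ZF ρ) (DF ρ) hu0 huz
        (hZq ρ hρ) (hSq ρ hρ) (hDq ρ hρ) (hg1 ρ hρ) (hZF ρ hρ) (hDF ρ hρ) (hx ρ hρ) (hg2 ρ hρ) (hZFz ρ hρ)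
        (hZall ρ hρ) (hD ρ hρ)
      have t2' : u1 * (a ρ * Zall) ≤ z1 * (c ρ * D2all) := by
        simp only [ha, hc]
        have e1 : u1 * ((Zq ρ * g2 ρ + Sq ρ * g1 ρ) * Zall) = u1 * (Zq ρ * g2 ρ + Sq ρ * g1 ρ) * Zall := by ring
        have e2 : z1 * ((Zq ρ * g1 ρ) * D2all) = z1 * (Zq ρ * g1 ρ) * D2all := by ring
        linarith [t2]
      have hz : z1 = 1 - u1 := by linarith
      have e : u1 * (a ρ * Zall + c ρ * D2all) = u1 * (a ρ * Zall) + u1 * (c ρ * D2all) := by ring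
      rw [e]
      rw [hz] at t2'
      have e3 : (1 - u1) * (c ρ * D2all) = c ρ * D2all - u1 * (c ρ * D2all) := by ring
      linarith
    have hS := Finset.sum_le_sum hpt
    have e1 : ∑ ρ ∈ S, P ρ * (u1 * (a ρ * Zall + c ρ * D2all)) = u1 * (As * Zall + Cs * D2all) := by
      rw [hAs, hCs, Finset.sum_mul, Finset.sum_mul, ← Finset.sum_add_distrib, Finset.mul_sum]
      apply Finset.sum_congr rfl; intro ρ _; ring
    have e2 : ∑ ρ ∈ S, P ρ * (c ρ * D2all) = Cs * D2all := by
      rw [hCs, Finset.sum_mul]; apply Finset.sum_congr rfl; intro ρ _; ring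
    rw [e1, e2] at hS; exact hS
  -- main part: the double sum of f ρ ρ' := P P' (u1 (a b' + c d') − c D2all) is ≤ 0
  set f : ι → ι → ℝ := fun ρ ρ' => P ρ * P ρ' * (u1 * (a ρ * b ρ' + c ρ * d ρ') - c ρ * D2all) with hf
  have hfsym : ∀ ρ ∈ S, ∀ ρ' ∈ S, f ρ ρ' + f ρ' ρ ≤ 0 := by
    intro ρ hρ ρ' hρ'
    have hpair := ratio_pair A1 u1 D2all (Zq ρ) (Sq ρ) (Dq ρ) (g1 ρ) (g2 ρ) (ZF ρ) (DF ρ)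
      (Zq ρ') (Sq ρ') (Dq ρ') (g1 ρ') (g2 ρ') (ZF ρ') (DF ρ') hu0 hu1
      (hZq ρ hρ) (hSq ρ hρ) (hDq ρ hρ) (hg1 ρ hρ) (le_trans (hZFz ρ hρ) hz1le) (hDF ρ hρ)
      (hZq ρ' hρ') (hSq ρ' hρ') (hDq ρ' hρ') (hg1 ρ' hρ') (le_trans (hZFz ρ' hρ') hz1le) (hDF ρ' hρ')
      (hx ρ hρ) (hgU ρ hρ) (hg2 ρ hρ) (hx ρ' hρ') (hgU ρ' hρ') (hg2 ρ' hρ') (hD ρ hρ) (hD ρ' hρ')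
    have hPP : 0 ≤ P ρ * P ρ' := mul_nonneg (hP ρ hρ) (hP ρ' hρ')
    have key : f ρ ρ' + f ρ' ρ = P ρ * P ρ' *
        (u1 * (a ρ * b ρ' + a ρ' * b ρ + c ρ * d ρ' + c ρ' * d ρ) - (c ρ + c ρ') * D2all) := by
      simp only [hf]; ring
    rw [key]
    apply mul_nonpos_of_nonneg_of_nonpos hPP
    simp only [ha, hb, hc, hd]
    linarith [hpair]
  have hdouble : ∑ ρ ∈ S, ∑ ρ' ∈ S, f ρ ρ' ≤ 0 := by
    have hswap : ∑ ρ ∈ S, ∑ ρ' ∈ S, f ρ ρ' = ∑ ρ ∈ S, ∑ ρ' ∈ S, f ρ' ρ := Finset.sum_comm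
    have h2 : ∑ ρ ∈ S, ∑ ρ' ∈ S, f ρ ρ' + ∑ ρ ∈ S, ∑ ρ' ∈ S, f ρ' ρ
        = ∑ ρ ∈ S, ∑ ρ' ∈ S, (f ρ ρ' + f ρ' ρ) := by
      rw [← Finset.sum_add_distrib]
      apply Finset.sum_congr rfl; intro ρ _
      rw [← Finset.sum_add_distrib]
    have h3 : ∑ ρ ∈ S, ∑ ρ' ∈ S, (f ρ ρ' + f ρ' ρ) ≤ 0 :=
      Finset.sum_nonpos (fun ρ hρ => Finset.sum_nonpos (fun ρ' hρ' => hfsym ρ hρ ρ' hρ'))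
    linarith
  -- expand the double sum: = u1 (As Bs + Cs Ds) − Cs D2all (1 − β)
  have hexp : ∑ ρ ∈ S, ∑ ρ' ∈ S, f ρ ρ' = u1 * (As * Bs + Cs * Ds) - Cs * D2all * (1 - β) := by
    have s1 : As * Bs = ∑ ρ ∈ S, ∑ ρ' ∈ S, (P ρ * a ρ) * (P ρ' * b ρ') := by rw [hAs, hBs, Finset.sum_mul_sum]
    have s2 : Cs * Ds = ∑ ρ ∈ S, ∑ ρ' ∈ S, (P ρ * c ρ) * (P ρ' * d ρ') := by rw [hCs, hDs, Finset.sum_mul_sum]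
    have s3 : Cs * D2all * (1 - β) = ∑ ρ ∈ S, ∑ ρ' ∈ S, (P ρ * c ρ * D2all) * P ρ' := by
      rw [← hsum, hCs, Finset.sum_mul, Finset.sum_mul_sum]
    rw [s1, s2, s3, mul_add, Finset.mul_sum, Finset.mul_sum, ← Finset.sum_add_distrib, ← Finset.sum_sub_distrib]
    apply Finset.sum_congr rfl; intro ρ _
    rw [Finset.mul_sum, Finset.mul_sum, ← Finset.sum_add_distrib, ← Finset.sum_sub_distrib]
    apply Finset.sum_congr rfl; intro ρ' _
    simp only [hf]; ring
  have hmain : u1 * (As * Bs + Cs * Ds) ≤ Cs * D2all * (1 - β) := by linarith [hdouble, hexp]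
  -- assemble
  rw [hN0', hDn0', homH', hT']
  have e : u1 * (As * (β * Zall + Bs) + Cs * (β * D2all + Ds))
      = β * (u1 * (As * Zall + Cs * D2all)) + u1 * (As * Bs + Cs * Ds) := by ring
  rw [e]
  have := mul_le_mul_of_nonneg_left hβpart hβ0
  nlinarith [this, hmain]

end Sums

end Block

end Quant

end Summit.CriticalPhenomena.PercolationContinuityZ3.Theorems
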